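import Summits.CriticalPhenomena.PercolationContinuityZ3.Theorems.PercNearOneGluingNoHeavyQuantEpsOrbitTable
import HarnessLib

/-!
# QUANT lane / PAPER-2 rate track (ARM-2 = constants bookkeeper, gen 4): the top of the dyadic table, `ε = 2⁻ᵃ` with `a = 0, 1, 2, 3`, and
# THE SHARP CEILING OF THE PEIERLS LEVER — `η(ε, 3) < 2⁻¹⁵⁰⁶` for every Peierls constant `0 < ε ≤ 1` (attained at `ε = 1`)

builds on p205010 (kernel theorem, internal audit signed; external expert review pending)

Cell `prim-quant`, seat `prim-quant-arm-2` (`run/shared/lean/prim/quant/prim-quant-arm-2/RATE-CONSTANTS.md` §2d/§2e).  Continuation of `…QuantEpsOrbitTable`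
(p248843: `a = 4..8`) in the same vocabulary and pattern: `K(1) = 67`, `K(2⁻¹) = 178`, `K(2⁻²) = 444`, `K(2⁻³) = 1065` exactly; `d = 3` orbit defects
`⌊log₂(1/η(2⁻ᵃ,3))⌋ = 1506, 1669, 1829, 1985` for `a = 0, 1, 2, 3` (interval values `1506.23`, `1669.90`, `1829.19`, `1985.78`; RATE-CONSTANTS §2's floating
`ε = 1/4` column `1829.2` is hereby kernel); `a = 0` also for `d = 4, 5, 6`: `4099`, `10415`, `25339`.  Since the cascade is monotone in `ε` up to `ε ≤ 8`
(`Quant.epsOrbitDefect_mono`, p247160), the row `a = 0` (`ε = 1`) IS the ceiling of the lever: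

* **`EpsSharp.epsOrbitDefect_three_lt_ceiling_sharp`: for EVERY `0 < ε ≤ 1`, `η(ε, 3) < 2⁻¹⁵⁰⁶`** — sharpening p247475's `2⁻¹⁴⁶⁸` (which used the `a = 0`
  BRACKET of p247160) to the last binary digit; attained: `2⁻¹⁵⁰⁷ < η(1, 3) < 2⁻¹⁵⁰⁶` (`epsOrbitDefect_one_three_sharp`);
* `d = 4, 5, 6`: `η(ε, d) < 2⁻⁴⁰⁹⁹`, `2⁻¹⁰⁴¹⁵`, `2⁻²⁵³³⁹` (were `3997`, `10161`, `24729`);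
* for displays: `1 − η(ε, 3) > 1 − 2⁻¹⁵⁰⁶` — whatever driver a future Peierls argument supplies, the `d = 3` base printed through
  `PkSharp.oneArm_le_base_pow_of_scaleDefect` stays above `1 − 2⁻¹⁵⁰⁶` inside this cascade.

So the base of the `d = 3` display ranges over `(1 − 2⁻¹⁵⁰⁶, 1)` as the Peierls constant ranges over `(0, 1]`: tree `6283.9` bits (`ε = 2⁻³²`, p213333), lever
`2747.7` (`2⁻⁸`, p245966/p248057), DFS target `2445.8` (`2⁻⁶`, p248843), floor `1506.2` (`ε = 1`).  What remains below the floor is structural to the scheme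
(two Markov squares, corridor constant `96(d+1)`, chain constant `200·K` with `K ≥ 67`, orbit exponent `d·2^d`).  HONEST SENTENCE (unchanged): the proved rate
at `p_c(ℤ^d)`, `d ≥ 3`, is of iterated-logarithm type — explicit functions tending to `0` and nothing more; every Peierls threshold moves the BASE only; polylog /
power law OPEN.  Second derivation: `run/sessions/prover-prim-quant-arm-2-g4-0/folder/code/eps_table.py` (exact integers).  No definitions, no sorries;
standard axioms.  [cite: KozmaNitzan2024, §4 Theorem 6 (pp. 25–31)]
-/

noncomputable section

namespace Summit.CriticalPhenomena.PercolationContinuityZ3.Theorems.Quant.EpsSharp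

open MeasureTheory Literature.Probability.Percolation Literature.Probability.LatticeModels

/-! ## The rows `a = 0, 1, 2, 3` and the sharp ceiling

`K(1) = 67`, `K(2⁻¹) = 178`, `K(2⁻²) = 444`, `K(2⁻³) = 1065`; `d = 3` orbit defects `⌊log₂(1/η)⌋ = 1506, 1669, 1829, 1985` (interval values `1506.23`,
`1669.90`, `1829.19`, `1985.78`).  Since the cascade is monotone in `ε` up to `ε ≤ 8` (`epsOrbitDefect_mono`, p247160), the row `a = 0` (`ε = 1`) IS the
ceiling of the lever: for EVERY Peierls constant `0 < ε ≤ 1`, `η(ε, 3) < 2⁻¹⁵⁰⁶` — sharpening p247475's `2⁻¹⁴⁶⁸` (which used the `a = 0` BRACKET) to the last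
binary digit, attained at `ε = 1`; `d = 4, 5, 6`: `2⁻⁴⁰⁹⁹`, `2⁻¹⁰⁴¹⁵`, `2⁻²⁵³³⁹` (were `3997`, `10161`, `24729`).  So inside this cascade the base of the
`d = 3` display ranges over `[1 − 2⁻¹⁵⁰⁶·², 1)` as the Peierls constant ranges over `(0, 1]`: tree `6283.9` (`2⁻³²`), lever `2747.7` (`2⁻⁸`), DFS target
`2445.8` (`2⁻⁶`), floor `1506.2` (`ε = 1`).  Class log* throughout. -/

/-- **`K(1) = 67`** (`a = 0`: `max 64 ⌈96·log 2⌉ = ⌈66.542…⌉`). [folklore] (numeric) -/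
theorem epsK_zero_eq : epsK ((1 / 2 : ℝ) ^ 0) = 67 := epsK_half_pow_eq_of 0 67 (by norm_num) (by norm_num) (by norm_num)

/-- **`K(2⁻¹) = 178`** (`⌈256·log 2⌉ = ⌈177.445…⌉`). [folklore] (numeric) -/
theorem epsK_one_eq : epsK ((1 / 2 : ℝ) ^ 1) = 178 := epsK_half_pow_eq_of 1 178 (by norm_num) (by norm_num) (by norm_num)

/-- **`K(2⁻²) = 444`** (`⌈640·log 2⌉ = ⌈443.614…⌉`; RATE-CONSTANTS §2's 'ε = 1/4 (K = 444)' column). [folklore] (numeric) -/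
theorem epsK_two_eq : epsK ((1 / 2 : ℝ) ^ 2) = 444 := epsK_half_pow_eq_of 2 444 (by norm_num) (by norm_num) (by norm_num)

/-- **`K(2⁻³) = 1065`** (`⌈1536·log 2⌉ = ⌈1064.674…⌉`). [folklore] (numeric) -/
theorem epsK_three_eq : epsK ((1 / 2 : ℝ) ^ 3) = 1065 := epsK_half_pow_eq_of 3 1065 (by norm_num) (by norm_num) (by norm_num)

/-- **`d = 3`, `a = 0` (`ε = 1`): `(1/2)^1507 < η(1, 3) < (1/2)^1506`** (interval value `log₂(1/η) = 1506.234`) — the value of the cascade at the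
largest meaningful Peierls constant. [folklore] (numeric) -/
theorem orbit_zero_three_sharp :
    (1 / 2 : ℝ) ^ 1507 < epsOrbitDefect ((1 / 2 : ℝ) ^ 0) 3 ∧ epsOrbitDefect ((1 / 2 : ℝ) ^ 0) 3 < (1 / 2 : ℝ) ^ 1506 := by
  rw [epsOrbitDefect_half_pow_castForm (by norm_num) 0]
  exact one_div_sandwich_of_nat (A := 2 ^ (3 * 2 ^ 3)) (C := 2 ^ (2 * 0) * ((96 * (3 + 1)) ^ 2 * 200)) (Klo := 67) (Khi := 67)
    (K := epsK ((1 / 2 : ℝ) ^ 0)) (n := 2 * (3 * 2 ^ 3)) (a := 1506) (by positivity) (by positivity) (by norm_num)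
    epsK_zero_eq.ge epsK_zero_eq.le (by decide +kernel) (by decide +kernel)

/-- **`d = 3`, `a = 1`: `(1/2)^1670 < η(2⁻¹, 3) < (1/2)^1669`** (interval value `1669.897`). [folklore] (numeric) -/
theorem orbit_one_three_sharp :
    (1 / 2 : ℝ) ^ 1670 < epsOrbitDefect ((1 / 2 : ℝ) ^ 1) 3 ∧ epsOrbitDefect ((1 / 2 : ℝ) ^ 1) 3 < (1 / 2 : ℝ) ^ 1669 := by
  rw [epsOrbitDefect_half_pow_castForm (by norm_num) 1]
  exact one_div_sandwich_of_nat (A := 2 ^ (3 * 2 ^ 3)) (C := 2 ^ (2 * 1) * ((96 * (3 + 1)) ^ 2 * 200)) (Klo := 178) (Khi := 178)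
    (K := epsK ((1 / 2 : ℝ) ^ 1)) (n := 2 * (3 * 2 ^ 3)) (a := 1669) (by positivity) (by positivity) (by norm_num)
    epsK_one_eq.ge epsK_one_eq.le (by decide +kernel) (by decide +kernel)

/-- **`d = 3`, `a = 2`: `(1/2)^1830 < η(2⁻², 3) < (1/2)^1829`** (interval value `1829.193`; RATE-CONSTANTS §2's floating '1829.2' certified). [folklore] (numeric) -/
theorem orbit_two_three_sharp :
    (1 / 2 : ℝ) ^ 1830 < epsOrbitDefect ((1 / 2 : ℝ) ^ 2) 3 ∧ epsOrbitDefect ((1 / 2 : ℝ) ^ 2) 3 < (1 / 2 : ℝ) ^ 1829 := by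
  rw [epsOrbitDefect_half_pow_castForm (by norm_num) 2]
  exact one_div_sandwich_of_nat (A := 2 ^ (3 * 2 ^ 3)) (C := 2 ^ (2 * 2) * ((96 * (3 + 1)) ^ 2 * 200)) (Klo := 444) (Khi := 444)
    (K := epsK ((1 / 2 : ℝ) ^ 2)) (n := 2 * (3 * 2 ^ 3)) (a := 1829) (by positivity) (by positivity) (by norm_num)
    epsK_two_eq.ge epsK_two_eq.le (by decide +kernel) (by decide +kernel)

/-- **`d = 3`, `a = 3`: `(1/2)^1986 < η(2⁻³, 3) < (1/2)^1985`** (interval value `1985.780`). [folklore] (numeric) -/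
theorem orbit_three_three_sharp :
    (1 / 2 : ℝ) ^ 1986 < epsOrbitDefect ((1 / 2 : ℝ) ^ 3) 3 ∧ epsOrbitDefect ((1 / 2 : ℝ) ^ 3) 3 < (1 / 2 : ℝ) ^ 1985 := by
  rw [epsOrbitDefect_half_pow_castForm (by norm_num) 3]
  exact one_div_sandwich_of_nat (A := 2 ^ (3 * 2 ^ 3)) (C := 2 ^ (2 * 3) * ((96 * (3 + 1)) ^ 2 * 200)) (Klo := 1065) (Khi := 1065)
    (K := epsK ((1 / 2 : ℝ) ^ 3)) (n := 2 * (3 * 2 ^ 3)) (a := 1985) (by positivity) (by positivity) (by norm_num)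
    epsK_three_eq.ge epsK_three_eq.le (by decide +kernel) (by decide +kernel)

/-- `d = 4`, `a = 0`: `(1/2)^4100 < η(1, 4) < (1/2)^4099` (interval value `4099.037`). [folklore] (numeric) -/
theorem orbit_zero_four_sharp :
    (1 / 2 : ℝ) ^ 4100 < epsOrbitDefect ((1 / 2 : ℝ) ^ 0) 4 ∧ epsOrbitDefect ((1 / 2 : ℝ) ^ 0) 4 < (1 / 2 : ℝ) ^ 4099 := by
  rw [epsOrbitDefect_half_pow_castForm (by norm_num) 0]
  exact one_div_sandwich_of_nat (A := 2 ^ (4 * 2 ^ 4)) (C := 2 ^ (2 * 0) * ((96 * (4 + 1)) ^ 2 * 200)) (Klo := 67) (Khi := 67)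
    (K := epsK ((1 / 2 : ℝ) ^ 0)) (n := 2 * (4 * 2 ^ 4)) (a := 4099) (by positivity) (by positivity) (by norm_num)
    epsK_zero_eq.ge epsK_zero_eq.le (by decide +kernel) (by decide +kernel)

/-- `d = 5`, `a = 0`: `(1/2)^10416 < η(1, 5) < (1/2)^10415` (interval value `10415.935`). [folklore] (numeric) -/
theorem orbit_zero_five_sharp :
    (1 / 2 : ℝ) ^ 10416 < epsOrbitDefect ((1 / 2 : ℝ) ^ 0) 5 ∧ epsOrbitDefect ((1 / 2 : ℝ) ^ 0) 5 < (1 / 2 : ℝ) ^ 10415 := by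
  rw [epsOrbitDefect_half_pow_castForm (by norm_num) 0]
  exact one_div_sandwich_of_nat (A := 2 ^ (5 * 2 ^ 5)) (C := 2 ^ (2 * 0) * ((96 * (5 + 1)) ^ 2 * 200)) (Klo := 67) (Khi := 67)
    (K := epsK ((1 / 2 : ℝ) ^ 0)) (n := 2 * (5 * 2 ^ 5)) (a := 10415) (by positivity) (by positivity) (by norm_num)
    epsK_zero_eq.ge epsK_zero_eq.le (by decide +kernel) (by decide +kernel)

/-- `d = 6`, `a = 0`: `(1/2)^25340 < η(1, 6) < (1/2)^25339` (interval value `25339.838`). [folklore] (numeric) -/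
theorem orbit_zero_six_sharp :
    (1 / 2 : ℝ) ^ 25340 < epsOrbitDefect ((1 / 2 : ℝ) ^ 0) 6 ∧ epsOrbitDefect ((1 / 2 : ℝ) ^ 0) 6 < (1 / 2 : ℝ) ^ 25339 := by
  rw [epsOrbitDefect_half_pow_castForm (by norm_num) 0]
  exact one_div_sandwich_of_nat (A := 2 ^ (6 * 2 ^ 6)) (C := 2 ^ (2 * 0) * ((96 * (6 + 1)) ^ 2 * 200)) (Klo := 67) (Khi := 67)
    (K := epsK ((1 / 2 : ℝ) ^ 0)) (n := 2 * (6 * 2 ^ 6)) (a := 25339) (by positivity) (by positivity) (by norm_num)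
    epsK_zero_eq.ge epsK_zero_eq.le (by decide +kernel) (by decide +kernel)

/-- **THE SHARP CEILING OF THE PEIERLS LEVER, `d = 3`**: for EVERY Peierls constant `0 < ε ≤ 1`, `η(ε, 3) < 2⁻¹⁵⁰⁶` — no driver whatsoever prints a
`d = 3` base below `1 − 2⁻¹⁵⁰⁶` inside this cascade (p247475 had `2⁻¹⁴⁶⁸` from the bracket; this is the exact value at `ε = 1`, where it is attained up
to the last binary digit: `η(1,3) > 2⁻¹⁵⁰⁷`).  builds on p205010 (kernel theorem, internal audit signed; external expert review pending). [folklore] (numeric) -/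
theorem epsOrbitDefect_three_lt_ceiling_sharp {ε : ℝ} (hε : 0 < ε) (h1 : ε ≤ 1) : epsOrbitDefect ε 3 < (1 / 2 : ℝ) ^ 1506 := by
  have hmono : epsOrbitDefect ε 3 ≤ epsOrbitDefect ((1 / 2 : ℝ) ^ 0) 3 := by
    rw [pow_zero]; exact epsOrbitDefect_mono (by norm_num) hε h1 (by norm_num)
  exact hmono.trans_lt orbit_zero_three_sharp.2

/-- The sharp ceiling is attained at `ε = 1`: `2⁻¹⁵⁰⁷ < η(1, 3) < 2⁻¹⁵⁰⁶`. [folklore] (numeric) -/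
theorem epsOrbitDefect_one_three_sharp :
    (1 / 2 : ℝ) ^ 1507 < epsOrbitDefect 1 3 ∧ epsOrbitDefect 1 3 < (1 / 2 : ℝ) ^ 1506 := by
  have h := orbit_zero_three_sharp
  rwa [pow_zero] at h

/-- **Sharp ceiling, `d = 4`**: `η(ε, 4) < 2⁻⁴⁰⁹⁹` for every `0 < ε ≤ 1` (p247475: `2⁻³⁹⁹⁷`). [folklore] (numeric) -/
theorem epsOrbitDefect_four_lt_ceiling_sharp {ε : ℝ} (hε : 0 < ε) (h1 : ε ≤ 1) : epsOrbitDefect ε 4 < (1 / 2 : ℝ) ^ 4099 := by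
  have hmono : epsOrbitDefect ε 4 ≤ epsOrbitDefect ((1 / 2 : ℝ) ^ 0) 4 := by
    rw [pow_zero]; exact epsOrbitDefect_mono (by norm_num) hε h1 (by norm_num)
  exact hmono.trans_lt orbit_zero_four_sharp.2

/-- **Sharp ceiling, `d = 5`**: `η(ε, 5) < 2⁻¹⁰⁴¹⁵` for every `0 < ε ≤ 1` (p247475: `2⁻¹⁰¹⁶¹`). [folklore] (numeric) -/
theorem epsOrbitDefect_five_lt_ceiling_sharp {ε : ℝ} (hε : 0 < ε) (h1 : ε ≤ 1) : epsOrbitDefect ε 5 < (1 / 2 : ℝ) ^ 10415 := by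
  have hmono : epsOrbitDefect ε 5 ≤ epsOrbitDefect ((1 / 2 : ℝ) ^ 0) 5 := by
    rw [pow_zero]; exact epsOrbitDefect_mono (by norm_num) hε h1 (by norm_num)
  exact hmono.trans_lt orbit_zero_five_sharp.2

/-- **Sharp ceiling, `d = 6`**: `η(ε, 6) < 2⁻²⁵³³⁹` for every `0 < ε ≤ 1` (p247475: `2⁻²⁴⁷²⁹`). [folklore] (numeric) -/
theorem epsOrbitDefect_six_lt_ceiling_sharp {ε : ℝ} (hε : 0 < ε) (h1 : ε ≤ 1) : epsOrbitDefect ε 6 < (1 / 2 : ℝ) ^ 25339 := by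
  have hmono : epsOrbitDefect ε 6 ≤ epsOrbitDefect ((1 / 2 : ℝ) ^ 0) 6 := by
    rw [pow_zero]; exact epsOrbitDefect_mono (by norm_num) hε h1 (by norm_num)
  exact hmono.trans_lt orbit_zero_six_sharp.2

/-- **Corollary for displays**: whatever scale defect of the form `η(ε, 3)` (`0 < ε ≤ 1`) a future driver supplies along a scale function `m ≤ L m ≤ knLHi 3 m`,
the base it prints through `PkSharp.oneArm_le_base_pow_of_scaleDefect` is `≥ 1 − 2⁻¹⁵⁰⁶`: concretely `1 − η(ε,3) > 1 − 2⁻¹⁵⁰⁶`.  The order of the rate (log*) is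
untouched by any of this. [folklore] (numeric) -/
theorem one_sub_epsOrbitDefect_three_gt {ε : ℝ} (hε : 0 < ε) (h1 : ε ≤ 1) : 1 - (1 / 2 : ℝ) ^ 1506 < 1 - epsOrbitDefect ε 3 :=
  sub_lt_sub_left (epsOrbitDefect_three_lt_ceiling_sharp hε h1) 1

/-! ## The single tolerance of the row `a = 3`

Appended at the end of the file so that no earlier line moves (`:55`, `:83`, `:117` are pinned by the paper sources). -/

/-- `d = 3`, `a = 3`: **`(1/2)^83 < τ_U(2⁻³, 3) < (1/2)^82`** (interval value `log₂ = −82.741`) — the single uniqueness tolerance of the `a = 3` row,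
the companion of `tauU_four_three_sharp` (EpsOrbitTable §3) one rung up; `η(2⁻³, 3) = τ_U(2⁻³, 3)^24` is `orbit_three_three_sharp`. [folklore] (numeric) -/
theorem tauU_three_three_sharp : (1 / 2 : ℝ) ^ 83 < epsTauU ((1 / 2 : ℝ) ^ 3) 3 ∧ epsTauU ((1 / 2 : ℝ) ^ 3) 3 < (1 / 2 : ℝ) ^ 82 := by
  rw [epsTauU_half_pow_castForm (by norm_num) 3]
  exact one_div_sandwich_of_nat (A := 2) (C := 2 ^ (2 * 3) * ((96 * (3 + 1)) ^ 2 * 200)) (Klo := 1065) (Khi := 1065)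
    (K := epsK ((1 / 2 : ℝ) ^ 3)) (n := 2) (a := 82) (by norm_num) (by positivity) (by norm_num) epsK_three_eq.ge epsK_three_eq.le
    (by decide +kernel) (by decide +kernel)

end Summit.CriticalPhenomena.PercolationContinuityZ3.Theorems.Quant.EpsSharp

end
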